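import Summits.QuantumFields.BalabanUV.Beta.EriceRemainderEnclosureHistoryAutonomyComparisonNonlinearLightPrep

/-!
# EriceRemainderEnclosureHistoryAutonomyComparisonNonlinearLightBase — (E120b) THE NONLINEAR LEVEL GAUGE IN THE DEEP REGION FOR EVERY ISOTONE EXCESS.  Base
# `B u = β₀ + Σ_{k<K} L_k·u_k` (`β₀ > 0`, `L ≥ 0`, `L_0 = 0`; any profile, any size); `B′ ≥ B` with a modulus and an ISOTONE excess of ANY size and steepness.
# **`base_gauge_light`**: at a row `n` with `u_n ≤ 1∕(5(K+1))`, configurations comparing from every pin `h_m`, `m ≥ n`, and `X_m ≥ 0` for `m ≥ n+1`: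
# `X_{n+1}·h_{n+1}² ≤ X_n·h_n²`.  PROOF = (E119c) `base_gauge_mod` with excess modulus `0`, the row inequality supplied by (E120a) `row_ge_light` — whose light-row
# hypothesis `T(m) ≤ 1`, `m ≥ n+2`, holds in the deep region automatically (`T ≤ (K−1)F ≤ (18∕25)(K−1)u ≤ 18∕125`).

Cell `pub-balaban`, β-function sub-cell, BINDER row D4 «RemainderConst leaves for Bałaban's split» (`HOME/BINDER-OWNERS.md`; owner lineage `b2b-balaban-beta-an4`;
this file by co-owner #2 lineage `b2b-balaban-beta-d4-p2`, generation 98), β-FLOW TEAM duty (1), FREEZE (0) honoured (def-free; imports (E120a) `…NonlinearLightPrep`; uses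
its `row_ge_light`, (E119b) `excess_facts` ∕ `excess_orbit_antitone` ∕ `conf_gap_le_excess` ∕ `step_ge_excess`, (E118c) `loads_le` ∕ `relstep_antitone`, (E118a) `affine_facts`,
(E58b) `increment_anti`, (E116b) `flow_budget_le` ∕ `flow_rate_decay_le`, (E117a) `flow_first_entry_le`, (E48a) `family_mem` ∕ `strictAnti_of_memFlow` BY NAME; the proof is
(E119c)'s, re-run — nothing else restated).

HONEST FRAMING (page 1, verbatim and binding).  *"Discharging BetaPertH makes Bałaban's UV stability UNCONDITIONAL — a real constructive-QFT result; it is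
NOT the continuum limit and NOT the Clay problem."*  THIS FILE DISCHARGES NOTHING OF THE KIND.  Elementary real analysis about ABSTRACT functionals on a box
]0,γ]^ℕ with displayed floors, moduli, profiles and signs — hypotheses of a census, not facts; the form, signs, ages and moments of Bałaban's (1.22) limit
functional are NOT PRINTED ([I] p. 298; GAPS G-t4-U2-1∕-2) and NOT asserted.  Row D4 class UNCHANGED (critical-path width 0; instance 0∕1; D4 DISCHARGE NO
DATE).  HONEST DEPENDENCY: continuum YM on T⁴ ⇐ BetaPertH ∧ nine spine estimates (0/9 proved); BetaPertH ⇐ (D1) ∧ (D4) ∧ CAP+tail; G-an2-4 gates asym, D1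
and NE2/3/4.  NOT CLAIMED here: the comparison theorem itself (the sequel); anything printed — NOT B12 Thm 2, NOT BetaPertH, NOT continuum, NOT Clay.

WHAT IS PROVED ([folklore]; 0 `def`, 0 sorry).  **`base_gauge_light`**.
-/

noncomputable section
open Finset Set

namespace Summit.QuantumFields.BalabanUV.Beta.EriceRemainderEnclosureHistoryAutonomyComparisonNonlinearLightBase

open Literature.MathematicalPhysics.QuantumFieldTheory.Balaban1983to89
open Literature.MathematicalPhysics.QuantumFieldTheory.Balaban1983to89.T4BetaStationary
open Literature.MathematicalPhysics.QuantumFieldTheory.Balaban1983to89.T4BetaFlowWellPosed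
open Summit.QuantumFields.BalabanUV.Beta.EriceRemainderEnclosureHistoryAutonomyOrder (family_mem strictAnti_of_memFlow)
open Summit.QuantumFields.BalabanUV.Beta.EriceRemainderEnclosureHistoryAutonomyComparisonAffineProfile (increment_anti)
open Summit.QuantumFields.BalabanUV.Beta.EriceRemainderEnclosureHistoryAutonomyComparisonAgeCompositionHeatingCriterionFlow (flow_budget_le flow_rate_decay_le)
open Summit.QuantumFields.BalabanUV.Beta.EriceRemainderEnclosureHistoryAutonomyComparisonAgeCompositionDampedLevelGaugePrep (flow_first_entry_le)
open Summit.QuantumFields.BalabanUV.Beta.EriceRemainderEnclosureHistoryAutonomyComparisonNonlinearRowPrep (affine_facts)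
open Summit.QuantumFields.BalabanUV.Beta.EriceRemainderEnclosureHistoryAutonomyComparisonNonlinearLightPrep (row_ge_light)
open Summit.QuantumFields.BalabanUV.Beta.EriceRemainderEnclosureHistoryAutonomyComparisonNonlinearLevelGaugePrep (loads_le relstep_antitone)
open Summit.QuantumFields.BalabanUV.Beta.EriceRemainderEnclosureHistoryAutonomyComparisonNonlinearModulusPrep

variable {B B' : (ℕ → ℝ) → ℝ} {γ β₀ M' : ℝ} {L : ℕ → ℝ} {K : ℕ} {S S' : ℝ → ℕ → ℝ}

/-! ## §1 The gauge in the deep region -/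

set_option maxHeartbeats 800000 in
/-- **THE LEVEL GAUGE IN THE DEEP REGION, EVERY ISOTONE EXCESS.**  Base orbit `h = S y`; at a row `n` with `u_n ≤ 1∕(5(K+1))`, configurations comparing from every pin
`h_m`, `m ≥ n`, and `X_m ≥ 0` for `m ≥ n+1`:  `X_{n+1}·h_{n+1}² ≤ X_n·h_n²` ((E120a) `row_ge_light`, the deep rows being light). [folklore] -/
theorem base_gauge_light (hBaff : ∀ u, SeqBox γ u → B u = β₀ + ∑ k ∈ range K, L k * u k) (hL : ∀ k, 0 ≤ L k) (hL0 : L 0 = 0) (hβ : 0 < β₀)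
    (hB' : ∀ u u' : ℕ → ℝ, SeqBox γ u → SeqBox γ u' → ∀ D : ℝ, (∀ j, |u j - u' j| ≤ D) → |B' u - B' u'| ≤ M' * D) (hM' : 0 ≤ M')
    (hexc : ∀ u, SeqBox γ u → B u ≤ B' u)
    (hDmono : ∀ u v : ℕ → ℝ, SeqBox γ u → SeqBox γ v → (∀ j, u j ≤ v j) → B' u - B u ≤ B' v - B v)
    (hS : ∀ p, 0 < p → p ≤ γ → SeqBox γ (S p) ∧ MemFlow B p (S p))
    (huniq : ∀ p, 0 < p → p ≤ γ → ∀ u u' : ℕ → ℝ, SeqBox γ u → SeqBox γ u' → MemFlow B p u → MemFlow B p u' → u = u')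
    (hS' : ∀ p, 0 < p → p ≤ γ → SeqBox γ (S' p) ∧ MemFlow B' p (S' p))
    (huniq' : ∀ p, 0 < p → p ≤ γ → ∀ u u' : ℕ → ℝ, SeqBox γ u → SeqBox γ u' → MemFlow B' p u → MemFlow B' p u' → u = u')
    {y : ℝ} (hy : 0 < y) (hyγ : y ≤ γ) (n : ℕ)
    (hu : (1 / S y (n + 1) ^ 2 - 1 / S y n ^ 2) * S y (n + 1) ^ 2 ≤ 1 / (5 * ((K : ℝ) + 1)))
    (hcmp : ∀ m, n ≤ m → ∀ j, S' (S y m) j ≤ S y (m + j)) (hX : ∀ m, n + 1 ≤ m → 0 ≤ B' (S' (S y m)) - B (S (S y m))) :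
    (B' (S' (S y (n + 1))) - B (S (S y (n + 1)))) * S y (n + 1) ^ 2 ≤ (B' (S' (S y n)) - B (S (S y n))) * S y n ^ 2 := by
  obtain ⟨hmono', hlo'⟩ := excess_facts hBaff hL hβ hexc hDmono
  obtain ⟨hmono, hlo, hdom, _⟩ := affine_facts hBaff hL hβ
  have hh := (hS y hy hyγ).1
  have hf := (hS y hy hyγ).2
  have hpos : ∀ j, 0 < S y j := fun j => (hh j).1
  have hanti := (strictAnti_of_memFlow hβ hlo hh hf).antitone
  -- abbreviations
  set X1 : ℝ := B' (S' (S y (n + 1))) - B (S (S y (n + 1))) with hX1def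
  set Da : ℝ := 1 / S y (n + 1) ^ 2 - 1 / S y n ^ 2 with hDa
  set un : ℝ := Da * S y (n + 1) ^ 2 with hun
  have hX10 : 0 ≤ X1 := hX (n + 1) le_rfl
  have hDa0 : 0 ≤ Da := by simp only [hDa]; rw [hf.2 n]; linarith [hlo _ (seqBox_shift hh (n + 1))]
  have hun0 : 0 ≤ un := mul_nonneg hDa0 (sq_nonneg _)
  have hK1 : (0 : ℝ) < 5 * ((K : ℝ) + 1) := by positivity
  have hKu : (K : ℝ) * un ≤ 1 / 5 := by
    have hK0 : (0 : ℝ) ≤ (K : ℝ) := Nat.cast_nonneg K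
    have h1 : (K : ℝ) * un ≤ (K : ℝ) * (1 / (5 * ((K : ℝ) + 1))) := mul_le_mul_of_nonneg_left hu hK0
    have h2 : (K : ℝ) * (1 / (5 * ((K : ℝ) + 1))) ≤ 1 / 5 := by
      rw [mul_one_div, div_le_div_iff₀ hK1 (by norm_num : (0:ℝ) < 5)]; nlinarith
    exact h1.trans h2
  -- the excess along the orbit: 0 ≤ e_{n+2} ≤ e_{n+1} ≤ e_n
  set e1 : ℝ := B' (S' (S y (n + 1))) - B (S' (S y (n + 1))) with he1def
  obtain ⟨he10, he1n⟩ := excess_orbit_antitone hBaff hL hβ hB' hM' hexc hDmono hS hS' huniq' hy hyγ n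
  obtain ⟨he20, he21⟩ := excess_orbit_antitone hBaff hL hβ hB' hM' hexc hDmono hS hS' huniq' hy hyγ (n + 1)
  rw [show n + 1 + 1 = n + 2 by ring] at he20 he21
  -- the row inequality with the excess modulus (0:ℝ)
  -- the deeper rows are light: T(m) ≤ (K−1)F(m) ≤ (18/25)(K−1)u_m ≤ 18/125 for m ≥ n
  have hTall : ∀ m, n + 2 ≤ m → ∑ k ∈ Ico 1 K, (k : ℝ) * (L k * S y (m + k) ^ 3 / 2) ≤ 1 := by
    intro m hm
    have hlm := loads_le (K := K) hL hpos m
    have hFm := flow_first_entry_le hmono hL hβ hlo hdom hh hf m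
    have hum : (1 / S y (m + 1) ^ 2 - 1 / S y m ^ 2) * S y (m + 1) ^ 2 ≤ un := relstep_antitone hmono hβ hlo hh hf (show n ≤ m by omega)
    have hF0 : 0 ≤ ∑ k ∈ Ico 1 K, L k * S y (m + k) ^ 3 / 2 := sum_nonneg fun k _ => by have := hL k; have := hpos (m + k); positivity
    have hK0 : (0 : ℝ) ≤ (K : ℝ) := Nat.cast_nonneg K
    have hFm' : ∑ k ∈ Ico 1 K, L k * S y (m + k) ^ 3 / 2 ≤ 18 / 25 * un := by
      refine hFm.trans ?_
      have := mul_le_mul_of_nonneg_left hum (by norm_num : (0:ℝ) ≤ 18 / 25)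
      linarith
    calc ∑ k ∈ Ico 1 K, (k : ℝ) * (L k * S y (m + k) ^ 3 / 2) ≤ ((K : ℝ) - 1) * ∑ k ∈ Ico 1 K, L k * S y (m + k) ^ 3 / 2 := hlm
      _ ≤ (K : ℝ) * (18 / 25 * un) := by nlinarith
      _ = 18 / 25 * ((K : ℝ) * un) := by ring
      _ ≤ 1 := by nlinarith
  have hME : (0 : ℝ) ≤ 0 := le_rfl
  have hMEγ : (0 : ℝ) * γ ≤ β₀ / 5 := by rw [zero_mul]; positivity
  have hrow := row_ge_light hBaff hL hL0 hβ hmono' hβ hB' hM' hlo' hexc hDmono hS huniq hS' huniq' hy hyγ n hcmp hTall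
  -- first entries: F(n) ≤ (18/25) u_n
  have hF := flow_first_entry_le hmono hL hβ hlo hdom hh hf n
  -- u is non-increasing: u_t ≤ u_n for t ≥ n
  have hurel : ∀ t, n ≤ t → (1 / S y (t + 1) ^ 2 - 1 / S y t ^ 2) * S y (t + 1) ^ 2 ≤ un := fun t ht =>
    relstep_antitone hmono hβ hlo hh hf ht
  -- e1 ≤ (125/107) X1
  have hT := step_ge_excess hBaff hL hβ hB' hM' hexc hDmono hS huniq hS' huniq' hy hyγ (n + 1) (fun m' hm' => hcmp m' (by omega))
  rw [show n + 1 + 1 = n + 2 by ring] at hT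
  have hloads := loads_le (K := K) hL hpos (n + 1)
  have hF1 := flow_first_entry_le hmono hL hβ hlo hdom hh hf (n + 1)
  have hu1 := hurel (n + 1) (by omega)
  have hTle : ∑ k ∈ Ico 1 K, (k : ℝ) * (L k * S y (n + 1 + k) ^ 3 / 2) ≤ 18 / 125 := by
    have hF1' : ∑ k ∈ Ico 1 K, L k * S y (n + 1 + k) ^ 3 / 2 ≤ 18 / 25 * un := by
      refine hF1.trans ?_
      have := mul_le_mul_of_nonneg_left hu1 (by norm_num : (0:ℝ) ≤ 18 / 25)
      linarith
    have hF10 : 0 ≤ ∑ k ∈ Ico 1 K, L k * S y (n + 1 + k) ^ 3 / 2 :=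
      sum_nonneg fun k _ => by have := hL k; have := hpos (n + 1 + k); positivity
    have hK0 : (0 : ℝ) ≤ K := Nat.cast_nonneg K
    calc ∑ k ∈ Ico 1 K, (k : ℝ) * (L k * S y (n + 1 + k) ^ 3 / 2) ≤ ((K : ℝ) - 1) * ∑ k ∈ Ico 1 K, L k * S y (n + 1 + k) ^ 3 / 2 := hloads
      _ ≤ (K : ℝ) * (18 / 25 * un) := by nlinarith
      _ = 18 / 25 * ((K : ℝ) * un) := by ring
      _ ≤ 18 / 125 := by nlinarith
  have hηX : e1 ≤ 125 / 107 * X1 := by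
    have hT0 : 0 ≤ ∑ k ∈ Ico 1 K, (k : ℝ) * (L k * S y (n + 1 + k) ^ 3 / 2) :=
      sum_nonneg fun k _ => by have := hL k; have := hpos (n + 1 + k); positivity
    have h1 : (∑ k ∈ Ico 1 K, (k : ℝ) * (L k * S y (n + 1 + k) ^ 3 / 2)) * (B' (S' (S y (n + 2))) - B (S' (S y (n + 2))))
        ≤ 18 / 125 * e1 := mul_le_mul hTle he21 he20 (by norm_num)
    have : e1 - 18 / 125 * e1 ≤ X1 := by linarith
    nlinarith
  -- per-age coefficient: decay + defect ≤ (111/100) β_k Da h(n+1)⁴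
  have hcoef : ∀ k ∈ Finset.Ico 1 K,
      L k * S y (n + k) ^ 3 / 2 - L k * S y (n + 1 + k) ^ 3 / 2
        + L k * S y (n + 1 + k) ^ 3 / 2 * (∑ q ∈ Ico 1 K, L q * S y (n + k + 1 + q) ^ 3 / 2)
      ≤ 111 / 100 * (L k * S y (n + 1 + k)) * Da * S y (n + 1) ^ 4 := by
    intro k hk
    have hk1 : 1 ≤ k := (Finset.mem_Ico.mp hk).1
    have hβk : 0 ≤ L k * S y (n + 1 + k) := mul_nonneg (hL k) (hpos _).le
    -- decay
    have hdec := flow_rate_decay_le hL hβ hlo hh hf k n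
    have hDk : 1 / S y (n + 1 + k) ^ 2 - 1 / S y (n + k) ^ 2 ≤ Da := by
      simp only [hDa]; rw [show n + 1 + k = (n + k) + 1 by ring, hf.2 (n + k), hf.2 n]
      have := increment_anti hmono hβ hlo hh hf (show n ≤ n + k by omega); linarith
    have h4 : S y (n + k) ^ 4 ≤ S y (n + 1) ^ 4 := pow_le_pow_left₀ (hpos _).le (hanti (by omega)) 4
    have hdec' : L k * S y (n + k) ^ 3 / 2 - L k * S y (n + 1 + k) ^ 3 / 2 ≤ 3 / 4 * (L k * S y (n + 1 + k)) * Da * S y (n + 1) ^ 4 := by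
      refine hdec.trans ?_
      have := mul_le_mul (mul_le_mul_of_nonneg_left hDk (by positivity : (0:ℝ) ≤ 3 / 4 * (L k * S y (n + 1 + k)))) h4
        (by have := hpos (n + k); positivity) (by positivity)
      linarith
    -- defect
    have hFk := flow_first_entry_le hmono hL hβ hlo hdom hh hf (n + k + 1)
    have huk := hurel (n + k + 1) (by omega)
    have hFk' : ∑ q ∈ Ico 1 K, L q * S y (n + k + 1 + q) ^ 3 / 2 ≤ 18 / 25 * un := by
      refine hFk.trans ?_
      have := mul_le_mul_of_nonneg_left huk (by norm_num : (0:ℝ) ≤ 18 / 25)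
      linarith
    have hc1 : L k * S y (n + 1 + k) ^ 3 / 2 ≤ (L k * S y (n + 1 + k)) * S y (n + 1) ^ 2 / 2 := by
      have h2 : S y (n + 1 + k) ^ 2 ≤ S y (n + 1) ^ 2 := pow_le_pow_left₀ (hpos _).le (hanti (by omega)) 2
      have := mul_le_mul_of_nonneg_left h2 hβk
      nlinarith
    have hdef : L k * S y (n + 1 + k) ^ 3 / 2 * (∑ q ∈ Ico 1 K, L q * S y (n + k + 1 + q) ^ 3 / 2)
        ≤ 9 / 25 * (L k * S y (n + 1 + k)) * Da * S y (n + 1) ^ 4 := by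
      have hF0 : 0 ≤ ∑ q ∈ Ico 1 K, L q * S y (n + k + 1 + q) ^ 3 / 2 :=
        sum_nonneg fun q _ => by have := hL q; have := hpos (n + k + 1 + q); positivity
      calc L k * S y (n + 1 + k) ^ 3 / 2 * (∑ q ∈ Ico 1 K, L q * S y (n + k + 1 + q) ^ 3 / 2)
          ≤ ((L k * S y (n + 1 + k)) * S y (n + 1) ^ 2 / 2) * (18 / 25 * un) :=
            mul_le_mul hc1 hFk' hF0 (by have := hpos (n + 1); positivity)
        _ = 9 / 25 * (L k * S y (n + 1 + k)) * Da * S y (n + 1) ^ 4 := by simp only [hun]; ring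
    linarith
  -- windows ≤ K η, and the sum of the heating/defect terms
  have hwin : ∀ k ∈ Finset.Ico 1 K, 0 ≤ 1 / S' (S y (n + 1)) (k - 1) ^ 2 - 1 / S y (n + k) ^ 2
      ∧ 1 / S' (S y (n + 1)) (k - 1) ^ 2 - 1 / S y (n + k) ^ 2 ≤ (K : ℝ) * e1 := by
    intro k hk
    obtain ⟨j, rfl⟩ : ∃ j, k = j + 1 := ⟨k - 1, by have := (Finset.mem_Ico.mp hk).1; omega⟩
    simp only [Nat.add_sub_cancel]
    have hgap' := conf_gap_le_excess hBaff hL hβ hB' hM' hexc hDmono hS huniq hS' huniq' hy hyγ (n + 1) (fun m' hm' => hcmp m' (by omega)) j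
    rw [show n + 1 + 1 = n + 2 by ring] at hgap'
    have hgap : 1 / S' (S y (n + 1)) j ^ 2 - 1 / S y (n + 1 + j) ^ 2 ≤ (j : ℝ) * e1 :=
      hgap'.trans (mul_le_mul_of_nonneg_left he21 (Nat.cast_nonneg j))
    rw [show n + 1 + j = n + (j + 1) by ring] at hgap
    have hjK : (j : ℝ) ≤ K := by have := (Finset.mem_Ico.mp hk).2; exact_mod_cast (by omega : j ≤ K)
    have hc := hcmp (n + 1) (by omega) j
    rw [show n + 1 + j = n + (j + 1) by ring] at hc
    have hq1 := family_mem hS hy hyγ (n + 1)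
    have hwp := ((hS' _ hq1.1 hq1.2).1 j).1
    exact ⟨sub_nonneg.mpr (one_div_le_one_div_of_le (pow_pos hwp 2) (pow_le_pow_left₀ hwp.le hc 2)),
      hgap.trans (mul_le_mul_of_nonneg_right hjK he10)⟩
  have hsum : ∑ k ∈ Ico 1 K, (L k * S y (n + k) ^ 3 / 2 - L k * S y (n + 1 + k) ^ 3 / 2
        + L k * S y (n + 1 + k) ^ 3 / 2 * (∑ q ∈ Ico 1 K, L q * S y (n + k + 1 + q) ^ 3 / 2 + (0:ℝ) * S y (n + k + 1) ^ 3 / 2))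
        * (1 / S' (S y (n + 1)) (k - 1) ^ 2 - 1 / S y (n + k) ^ 2)
      ≤ ∑ k ∈ Ico 1 K, 111 / 100 * (L k * S y (n + 1 + k)) * Da * S y (n + 1) ^ 4 * ((K : ℝ) * e1)
        + ∑ k ∈ Ico 1 K, (L k * S y (n + 1 + k)) * ((0:ℝ) * γ * S y (n + 1) ^ 4 / 4) * ((K : ℝ) * e1) := by
    rw [← sum_add_distrib]
    refine sum_le_sum fun k hk => ?_
    obtain ⟨hw0, hwK⟩ := hwin k hk
    have hβk : 0 ≤ 111 / 100 * (L k * S y (n + 1 + k)) * Da * S y (n + 1) ^ 4 := by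
      have := hL k; have := hpos (n + 1 + k); have := hpos (n + 1); positivity
    have hLk := hL k
    have hxk := hpos (n + 1 + k)
    -- the (0:ℝ) part of the coefficient: c'·((0:ℝ) h³/2) ≤ (L h)·(MEγ h(n+1)⁴/4)
    have hγk : S y (n + k + 1) ≤ γ := (hh _).2
    have h2k : S y (n + k + 1) ^ 2 ≤ S y (n + 1) ^ 2 := pow_le_pow_left₀ (hpos _).le (hanti (by omega)) 2
    have h2k' : S y (n + 1 + k) ^ 2 ≤ S y (n + 1) ^ 2 := pow_le_pow_left₀ (hpos _).le (hanti (by omega)) 2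
    have hγ0' : 0 ≤ γ := ((hh 0).1.le).trans (hh 0).2
    have hME3 : (0:ℝ) * S y (n + k + 1) ^ 3 / 2 ≤ (0:ℝ) * γ * S y (n + 1) ^ 2 / 2 := by
      have h3 : S y (n + k + 1) ^ 3 ≤ γ * S y (n + 1) ^ 2 := by
        calc S y (n + k + 1) ^ 3 = S y (n + k + 1) * S y (n + k + 1) ^ 2 := by ring
          _ ≤ γ * S y (n + 1) ^ 2 := mul_le_mul hγk h2k (sq_nonneg _) hγ0'
      have := mul_le_mul_of_nonneg_left h3 hME
      have e3 : (0:ℝ) * (γ * S y (n + 1) ^ 2) = (0:ℝ) * γ * S y (n + 1) ^ 2 := by ring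
      rw [e3] at this
      exact div_le_div_of_nonneg_right this (by norm_num)
    have hcME : L k * S y (n + 1 + k) ^ 3 / 2 * ((0:ℝ) * S y (n + k + 1) ^ 3 / 2) ≤ (L k * S y (n + 1 + k)) * ((0:ℝ) * γ * S y (n + 1) ^ 4 / 4) := by
      have hc1 : L k * S y (n + 1 + k) ^ 3 / 2 ≤ (L k * S y (n + 1 + k)) * S y (n + 1) ^ 2 / 2 := by
        have := mul_le_mul_of_nonneg_left h2k' (mul_nonneg hLk hxk.le)
        have e4 : L k * S y (n + 1 + k) ^ 3 = L k * S y (n + 1 + k) * S y (n + 1 + k) ^ 2 := by ring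
        rw [e4]
        exact div_le_div_of_nonneg_right this (by norm_num)
      calc L k * S y (n + 1 + k) ^ 3 / 2 * ((0:ℝ) * S y (n + k + 1) ^ 3 / 2)
          ≤ ((L k * S y (n + 1 + k)) * S y (n + 1) ^ 2 / 2) * ((0:ℝ) * γ * S y (n + 1) ^ 2 / 2) :=
            mul_le_mul hc1 hME3 (by have := hpos (n + k + 1); positivity) (by positivity)
        _ = (L k * S y (n + 1 + k)) * ((0:ℝ) * γ * S y (n + 1) ^ 4 / 4) := by ring
    have hcoef' : L k * S y (n + k) ^ 3 / 2 - L k * S y (n + 1 + k) ^ 3 / 2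
          + L k * S y (n + 1 + k) ^ 3 / 2 * (∑ q ∈ Ico 1 K, L q * S y (n + k + 1 + q) ^ 3 / 2 + (0:ℝ) * S y (n + k + 1) ^ 3 / 2)
        ≤ 111 / 100 * (L k * S y (n + 1 + k)) * Da * S y (n + 1) ^ 4 + (L k * S y (n + 1 + k)) * ((0:ℝ) * γ * S y (n + 1) ^ 4 / 4) := by
      have e : L k * S y (n + k) ^ 3 / 2 - L k * S y (n + 1 + k) ^ 3 / 2
            + L k * S y (n + 1 + k) ^ 3 / 2 * (∑ q ∈ Ico 1 K, L q * S y (n + k + 1 + q) ^ 3 / 2 + (0:ℝ) * S y (n + k + 1) ^ 3 / 2)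
          = (L k * S y (n + k) ^ 3 / 2 - L k * S y (n + 1 + k) ^ 3 / 2
              + L k * S y (n + 1 + k) ^ 3 / 2 * (∑ q ∈ Ico 1 K, L q * S y (n + k + 1 + q) ^ 3 / 2))
            + L k * S y (n + 1 + k) ^ 3 / 2 * ((0:ℝ) * S y (n + k + 1) ^ 3 / 2) := by ring
      rw [e]; exact add_le_add (hcoef k hk) hcME
    have hγ0 : 0 ≤ γ := ((hh 0).1.le).trans (hh 0).2
    have h14 : 0 ≤ S y (n + 1) ^ 4 := pow_nonneg (hpos _).le 4
    have hA1 : 0 ≤ 111 / 100 * (L k * S y (n + 1 + k)) * Da * S y (n + 1) ^ 4 :=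
      mul_nonneg (mul_nonneg (mul_nonneg (by norm_num) (mul_nonneg hLk hxk.le)) hDa0) h14
    have hA2 : 0 ≤ (L k * S y (n + 1 + k)) * ((0:ℝ) * γ * S y (n + 1) ^ 4 / 4) :=
      mul_nonneg (mul_nonneg hLk hxk.le) (div_nonneg (mul_nonneg (mul_nonneg hME hγ0) h14) (by norm_num))
    have h0' : 0 ≤ 111 / 100 * (L k * S y (n + 1 + k)) * Da * S y (n + 1) ^ 4 + (L k * S y (n + 1 + k)) * ((0:ℝ) * γ * S y (n + 1) ^ 4 / 4) :=
      add_nonneg hA1 hA2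
    have this : (L k * S y (n + k) ^ 3 / 2 - L k * S y (n + 1 + k) ^ 3 / 2
          + L k * S y (n + 1 + k) ^ 3 / 2 * (∑ q ∈ Ico 1 K, L q * S y (n + k + 1 + q) ^ 3 / 2 + (0:ℝ) * S y (n + k + 1) ^ 3 / 2))
          * (1 / S' (S y (n + 1)) (k - 1) ^ 2 - 1 / S y (n + k) ^ 2)
        ≤ (111 / 100 * (L k * S y (n + 1 + k)) * Da * S y (n + 1) ^ 4 + (L k * S y (n + 1 + k)) * ((0:ℝ) * γ * S y (n + 1) ^ 4 / 4)) * ((K : ℝ) * e1) :=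
      mul_le_mul hcoef' hwK hw0 h0'
    have e2 : (111 / 100 * (L k * S y (n + 1 + k)) * Da * S y (n + 1) ^ 4 + (L k * S y (n + 1 + k)) * ((0:ℝ) * γ * S y (n + 1) ^ 4 / 4)) * ((K : ℝ) * e1)
        = 111 / 100 * (L k * S y (n + 1 + k)) * Da * S y (n + 1) ^ 4 * ((K : ℝ) * e1)
          + (L k * S y (n + 1 + k)) * ((0:ℝ) * γ * S y (n + 1) ^ 4 / 4) * ((K : ℝ) * e1) := by ring
    rw [e2] at this
    exact this
  rw [← sum_mul, ← sum_mul, ← sum_mul, ← sum_mul, ← sum_mul] at hsum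
  have hbud : ∑ k ∈ Ico 1 K, 111 / 100 * (L k * S y (n + 1 + k)) ≤ 111 / 100 * Da := by
    rw [← mul_sum]
    refine mul_le_mul_of_nonneg_left ?_ (by norm_num)
    have hb' := flow_budget_le hdom hh hf n
    calc ∑ k ∈ Ico 1 K, L k * S y (n + 1 + k) ≤ ∑ k ∈ range K, L k * S y (n + 1 + k) :=
          sum_le_sum_of_subset_of_nonneg (fun k hk => mem_range.mpr (Finset.mem_Ico.mp hk).2) fun k _ _ => mul_nonneg (hL k) (hpos _).le
      _ ≤ Da := hb'
  -- assemble: X n ≥ X1 − (18/25) un X1 − (111/100) Da² h⁴ K η ≥ X1 (1 − un)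
  have h1sq : 0 < S y (n + 1) ^ 2 := pow_pos (hpos _) 2
  have hn2 : 0 < S y n ^ 2 := pow_pos (hpos _) 2
  have hmain : X1 * (1 - un) ≤ B' (S' (S y n)) - B (S (S y n)) := by
    have hA : (∑ k ∈ Ico 1 K, L k * S y (n + k) ^ 3 / 2) * X1 ≤ 18 / 25 * un * X1 := by
      have := mul_le_mul_of_nonneg_right hF hX10; simp only [hun, hDa]; linarith
    have hB : (∑ k ∈ Ico 1 K, 111 / 100 * (L k * S y (n + 1 + k))) * Da * S y (n + 1) ^ 4 * ((K : ℝ) * e1)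
        ≤ 111 / 100 * Da * Da * S y (n + 1) ^ 4 * ((K : ℝ) * e1) := by
      have : 0 ≤ Da * S y (n + 1) ^ 4 * ((K : ℝ) * e1) := by positivity
      calc (∑ k ∈ Ico 1 K, 111 / 100 * (L k * S y (n + 1 + k))) * Da * S y (n + 1) ^ 4 * ((K : ℝ) * e1)
          = (∑ k ∈ Ico 1 K, 111 / 100 * (L k * S y (n + 1 + k))) * (Da * S y (n + 1) ^ 4 * ((K : ℝ) * e1)) := by ring
        _ ≤ (111 / 100 * Da) * (Da * S y (n + 1) ^ 4 * ((K : ℝ) * e1)) := mul_le_mul_of_nonneg_right hbud this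
        _ = 111 / 100 * Da * Da * S y (n + 1) ^ 4 * ((K : ℝ) * e1) := by ring
    have hC : 111 / 100 * Da * Da * S y (n + 1) ^ 4 * ((K : ℝ) * e1) = 111 / 100 * un * ((K : ℝ) * un) * e1 := by simp only [hun]; ring
    have hD : 111 / 100 * un * ((K : ℝ) * un) * e1 ≤ 111 / 100 * un * (1 / 5) * (125 / 107 * X1) :=
      mul_le_mul (mul_le_mul_of_nonneg_left hKu (by positivity)) hηX he10 (by positivity)
    -- the (0:ℝ) part: (Σ_k L_k h_{n+1+k})·(MEγ h⁴/4)·(K e1) ≤ Da·(β₀/5) h⁴/4·(K e1) ≤ un·(Da h²)… ≤ un/100 · (125/107) X1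
    have hbud' : ∑ k ∈ Ico 1 K, L k * S y (n + 1 + k) ≤ Da := by
      have hb' := flow_budget_le hdom hh hf n
      calc ∑ k ∈ Ico 1 K, L k * S y (n + 1 + k) ≤ ∑ k ∈ range K, L k * S y (n + 1 + k) :=
            sum_le_sum_of_subset_of_nonneg (fun k hk => mem_range.mpr (Finset.mem_Ico.mp hk).2) fun k _ _ => mul_nonneg (hL k) (hpos _).le
        _ ≤ Da := hb'
    have hDaβ : β₀ ≤ Da := by simp only [hDa]; rw [hf.2 n]; linarith [hlo _ (seqBox_shift hh (n + 1))]
    have hE : (∑ k ∈ Ico 1 K, L k * S y (n + 1 + k)) * ((0:ℝ) * γ * S y (n + 1) ^ 4 / 4) * ((K : ℝ) * e1) ≤ 1 / 100 * un * (125 / 107 * X1) := by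
      have h1 : (∑ k ∈ Ico 1 K, L k * S y (n + 1 + k)) * ((0:ℝ) * γ * S y (n + 1) ^ 4 / 4) * ((K : ℝ) * e1)
          ≤ Da * (β₀ / 5 * S y (n + 1) ^ 4 / 4) * ((K : ℝ) * e1) := by
        have hγ0 : 0 ≤ γ := ((hh 0).1.le).trans (hh 0).2
        have h4p := pow_pos (hpos (n + 1)) 4
        have hin : (0:ℝ) * γ * S y (n + 1) ^ 4 / 4 ≤ β₀ / 5 * S y (n + 1) ^ 4 / 4 := by nlinarith
        apply mul_le_mul (mul_le_mul hbud' hin (by positivity) hDa0) le_rfl (by positivity) (by positivity)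
      have h2 : Da * (β₀ / 5 * S y (n + 1) ^ 4 / 4) * ((K : ℝ) * e1) = 1 / 20 * (β₀ * S y (n + 1) ^ 2) * ((K : ℝ) * un) * e1 := by
        simp only [hun]; ring
      have h3 : β₀ * S y (n + 1) ^ 2 ≤ un := by simp only [hun]; exact mul_le_mul_of_nonneg_right hDaβ (sq_nonneg _)
      have h4 : 1 / 20 * (β₀ * S y (n + 1) ^ 2) * ((K : ℝ) * un) * e1 ≤ 1 / 20 * un * (1 / 5) * (125 / 107 * X1) :=
        mul_le_mul (mul_le_mul (mul_le_mul_of_nonneg_left h3 (by norm_num)) hKu (by positivity) (by positivity)) hηX he10 (by positivity)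
      linarith
    have hnum : 18 / 25 * un * X1 + 111 / 100 * un * (1 / 5) * (125 / 107 * X1) + 1 / 100 * un * (125 / 107 * X1) ≤ un * X1 := by
      linarith [mul_nonneg hun0 hX10]
    have hΔe : 0 ≤ (B' (S' (S y n)) - B (S' (S y n))) - e1 := by linarith
    linarith [hrow, hsum, hA, hB, hC, hD, hE, hnum, hΔe]
  -- 1 − un = h(n+1)²/h(n)²
  have e : 1 - un = S y (n + 1) ^ 2 * (1 / S y n ^ 2) := by
    simp only [hun, hDa]; rw [sub_mul, one_div_mul_cancel h1sq.ne']; ring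
  rw [e] at hmain
  have := mul_le_mul_of_nonneg_right hmain hn2.le
  have e2 : X1 * (S y (n + 1) ^ 2 * (1 / S y n ^ 2)) * S y n ^ 2 = X1 * S y (n + 1) ^ 2 := by
    rw [mul_assoc, mul_assoc, one_div_mul_cancel hn2.ne', mul_one]
  rw [e2] at this
  linarith


end Summit.QuantumFields.BalabanUV.Beta.EriceRemainderEnclosureHistoryAutonomyComparisonNonlinearLightBase

end
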